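import Summits.HubbardSuperconductivity.HubbardSuperconductivity.Theses.SpinStructureRigidity
import Literature.MathematicalPhysics.QuantumLattice.TwistedHoppingPlaneWaves
import HarnessLib

/-!
# Crux `SsrRigidity` (stmt-HubbardSuperconductivity-1488; route `SpinStructureRigidity`, rank 2) —
line `birth`, skeleton RESHAPED by the c2 lead (2026-08-17)

THE CRUX (fixed; decl `Theses.SpinStructureRigidity.SsrRigidity`, NOT restated here): there are
`U > 0`, `μ`, a density `n ∈ (3/5, 1)` and `κ₀ > 0` such that (D) the grand-canonical density of
`hubbardTorusWith 2 (L+1) 1 U μ` at `β = κ(L+1)` tends to `n` for every `κ ≥ κ₀`, and for every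
`κ ≥ κ₀`, `ε > 0`, eventually in even `L`, with `H_L(θ) = dΓ(T_L(θ,μ)) + hubbardTorus 2 L 0 U`
(the inlined `Matrix.of` is `twistedOneBody L θ μ` by `rfl`, `twistedOneBody_eq_inline`),
`Z(θ) = Re tr e^{-κL H_L(θ)}` and `Z_P(θ) = Re tr[(-1)^N e^{-κL H_L(θ)}]`:
(R1) `e^{-C} Z(0) ≤ Z(θ) ≤ e^{C} Z(0)` on `θ ∈ {0,π}²`; (R2) `Z(θ) ≤ e^{-cL} Z(0)` whenever some
`θᵢ` is `ε`-far from `πℤ`; (T) `Σ_{θ ∈ {0,π}²} |Z_P(θ)| ≥ e^{-C} Z(0)`.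

THE LINE (`birth`, planner-skel 2026-08-17; composition idea unchanged: CONSTRUCTION ∕ MECHANISM
sharing the phase point) with the STRUCTURAL content separated out by the lead so that it is
registered and worker-sized:

1. `stub_fluxRigidPhase` — THE CONSTRUCTION (crux-sized residual, held by the lead). A phase
   point `(U > 0, μ, n ∈ (3/5,1), κ₀ > 0)` of the pure `t' = 0` Hubbard torus, stated over the ONE
   family `H_L(θ) = dΓ(twistedOneBody L θ μ) + hubbardTorus 2 L 0 U`: (D') the density of the
   Gibbs state of `H_{L+1}(0)` at `β = κ(L+1)` tends to `n`; (R1) verbatim; (R2') the twist cost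
   `Z(θ) ≤ e^{-cL} Z(0)` for `θ` in the fundamental box `[0,2π)²` with some `θᵢ` `ε`-far from `πℤ`.
2. `stub_parityOrbitOfFluxRigidity` — TEMPORAL RIGIDITY FROM SPATIAL RIGIDITY (verbatim as
   registered by the planner): at every phase point of the window, (D) + the full flux half
   (R1)+(R2) imply (T).
3. `stub_fluxPeriodic` — `2πℤ²`-PERIODICITY OF THE TWISTED PARTITION FUNCTION (structural,
   provable now): `tr e^{-β H_L(θ + 2πm)} = tr e^{-β H_L(θ)}` for `m ∈ ℤ²`, every `L ≥ 1`, by the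
   large gauge transformation `c_{x} ↦ e^{2πi m·x/L} c_{x}` (single valued on the torus), which maps
   `twistedOneBody L θ μ` to `twistedOneBody L (θ + 2πm) μ` and fixes the interaction
   (`phaseGauge`, `phaseGauge_mul_creation_mul_conjTranspose`; Byers–Yang 1961; Watanabe 2019 §2.2).
4. `stub_untwisted_eq_hubbardTorusWith` — THE UNTWISTED MEMBER IS THE ROUTE'S HAMILTONIAN
   (structural, provable now): `dΓ(twistedOneBody L 0 μ) + hubbardTorus 2 L 0 U =
   hubbardTorusWith 2 L 1 U μ` for `L ≥ 3` (both are `-Σ_{⟨xy⟩,σ} c†c + U Σ n↑n↓ - μN`; for `L = 2`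
   the directed-bond sum double counts, cf. `magneticHubbardTorus_one_eq_hubbardTorus`). This is
   also content (i) of the sibling crux `SsrBridge`.

COMPOSITION `SsrRigidity_of : SsrRigidity` (A12: concludes the crux BY NAME, no hypotheses, cites
the declared stubs by name; sorry-free outside the stubs): phase point from stub 1; (D) from (D')
by stub 4 (the two density sequences agree for `L + 1 ≥ 3`, `Filter.Tendsto.congr'`); the full
(R2) from (R2') by stub 3 (shift each `θᵢ` by `-2π⌊θᵢ/2π⌋`, which preserves `Z` and the distance
to `πℤ`); then stub 2 gives (T) at the same point; constants merged (`max C₁ C₂`, `max L₁ L₂`)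
using `0 ≤ Z(0)` (Hermiticity + `Matrix.partitionFn_pos`) and monotonicity of `exp`.

DISPROOF USED: none exists (no `Cruxes/SsrRigidity/Disproof.lean`, no `Theorems/SsrRigidity/
Negative/*`, 2026-08-17). Sources: Byers–Yang PRL 7 (1961) 46; 't Hooft NPB 153 (1979) 141;
Fisher–Barber–Jasnow PRA 8 (1973) 1111; Scalapino–White–Zhang PRB 47 (1993) 7995; Assaad–Hanke–
Scalapino PRL 71 (1993) 1915; Matveev–Larkin PRL 78 (1997) 3749; Watanabe J. Stat. Phys. 177
(2019) 717 §2.2 (large gauge transformations / twist operator). No definition is introduced.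
-/

noncomputable section

-- `dupNamespace`: the summit and the problem are both named `HubbardSuperconductivity` (layout D-0022)
set_option linter.dupNamespace false

namespace Summit.HubbardSuperconductivity.HubbardSuperconductivity.Cruxes.SsrRigidity.Birth

open Matrix Literature.MathematicalPhysics.QuantumLattice
open scoped ComplexOrder

/-! ## The stubs -/

/-- **STUB 1 `stub_fluxRigidPhase` — THE CONSTRUCTION** (the bet; crux-sized residual). Some
phase point `(U > 0, μ, n ∈ (3/5,1), κ₀ > 0)` of the pure `t' = 0` Hubbard torus, in terms of the
twisted family `H_L(θ) = dΓ(twistedOneBody L θ μ) + hubbardTorus 2 L 0 U`, has (D') density of the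
Gibbs state of `H_{L+1}(0)` at `β = κ(L+1)` tending to `n` for every `κ ≥ κ₀`, and, for every
`κ ≥ κ₀`, `ε > 0`, eventually in even `L`: (R1) `e^{-C} Z(0) ≤ Z(θ) ≤ e^{C} Z(0)` on the
pair-invisible fluxes `θ ∈ {0,π}²` (`h/2e` flux quantisation in free-energy form) and (R2') the
twist cost `Z(θ) ≤ e^{-cL} Z(0)` for every `θ ∈ [0,2π)²` with some `θᵢ` `ε`-far from `πℤ`
(charge-`2e` stiffness as a large deviation). Not claimed provable now. Byers–Yang (1961);
Scalapino–White–Zhang, PRB 47 (1993) 7995 §II; Assaad–Hanke–Scalapino, PRL 71 (1993) 1915. -/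
theorem stub_fluxRigidPhase :
    ∃ U : ℝ, 0 < U ∧ ∃ μ : ℝ, ∃ n ∈ Set.Ioo (3/5 : ℝ) 1, ∃ κ₀ : ℝ, 0 < κ₀ ∧
      (∀ κ : ℝ, κ₀ ≤ κ → Filter.Tendsto (fun L : ℕ =>
          ((dGamma (twistedOneBody (L + 1) 0 μ) + hubbardTorus 2 (L + 1) 0 U).gibbsState
            (κ * ((L + 1 : ℕ) : ℝ)) totalNumber).re / ((L + 1 : ℕ) : ℝ) ^ 2)
          Filter.atTop (nhds n)) ∧
      (∀ κ : ℝ, κ₀ ≤ κ → ∀ ε : ℝ, 0 < ε → ∃ C c : ℝ, 0 < c ∧ ∃ L₀ : ℕ, ∀ (L : ℕ) [NeZero L],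
          Even L → L₀ ≤ L →
        let H : (Fin 2 → ℝ) → Matrix (Finset (Orb (FermionTorus 2 L))) (Finset (Orb (FermionTorus 2 L))) ℂ :=
          fun θ => dGamma (twistedOneBody L θ μ) + hubbardTorus 2 L 0 U
        let Z : (Fin 2 → ℝ) → ℝ := fun θ => ((H θ).partitionFn (κ * L)).re
        (∀ θ : Fin 2 → ℝ, (∀ i, θ i = 0 ∨ θ i = Real.pi) →
            Real.exp (-C) * Z 0 ≤ Z θ ∧ Z θ ≤ Real.exp C * Z 0) ∧
        (∀ θ : Fin 2 → ℝ, (∀ i, 0 ≤ θ i ∧ θ i < 2 * Real.pi) →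
            (∃ i, ∀ m : ℤ, ε ≤ |θ i - m * Real.pi|) → Z θ ≤ Real.exp (-(c * L)) * Z 0)) := by
  sorry

/-- **STUB 2 `stub_parityOrbitOfFluxRigidity` — TEMPORAL RIGIDITY FROM SPATIAL RIGIDITY** (the
mechanism; verbatim the planner's registered stub). At EVERY phase point of the window — `U > 0`,
`κ₀ > 0`, `n ∈ (3/5,1)`, density clause (D) — the flux half (R1)+(R2) of the crux (verbatim the flux
hypothesis of `SsrBridge`) implies temporal rigidity of the pair-invisible orbit: for every
`κ ≥ κ₀` there are `C`, `L₀` with `e^{-C} Z(0) ≤ Σ_{θ ∈ {0,π}²} |Z_P(θ)|` for all even `L ≥ L₀`.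
Content: a flux-rigid phase is a charge-`2e` condensate of the electrons, gapped or nodal on the
twisted grids, so the `Π tanh²(κL E/2)`-type parity ratio is bounded below on at least one of the
four half-shifted grids; a residual Fermi surface collapses all four (`SsrFreeParityCollapse`,
proved). Why it might fail: a flux-rigid condensate with a Bogoliubov Fermi surface passes
(R1)+(R2) yet collapses the orbit. Matveev–Larkin, PRL 78 (1997) 3749; Read–Green, PRB 61 (2000)
10267; Raghu–Kivelson–Scalapino, PRB 81 (2010) 224505. -/
theorem stub_parityOrbitOfFluxRigidity :
    ∀ (U μ κ₀ n : ℝ), 0 < U → 0 < κ₀ → n ∈ Set.Ioo (3/5 : ℝ) 1 →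
      (∀ κ : ℝ, κ₀ ≤ κ → Filter.Tendsto (fun L : ℕ =>
          ((Literature.MathematicalPhysics.QuantumLattice.hubbardTorusWith 2 (L + 1) 1 U
          μ).gibbsState (κ * ((L + 1 : ℕ) : ℝ))
          Literature.MathematicalPhysics.QuantumLattice.totalNumber).re / ((L + 1 : ℕ) : ℝ) ^ 2)
          Filter.atTop (nhds n)) →
      (∀ κ : ℝ, κ₀ ≤ κ → ∀ ε : ℝ, 0 < ε → ∃ C c : ℝ, 0 < c ∧ ∃ L₀ : ℕ, ∀ (L : ℕ) [NeZero L], Even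
          L → L₀ ≤ L →
        let H : (Fin 2 → ℝ) → Matrix (Finset (Literature.MathematicalPhysics.QuantumLattice.Orb
          (Literature.MathematicalPhysics.QuantumLattice.FermionTorus 2 L))) (Finset
          (Literature.MathematicalPhysics.QuantumLattice.Orb
          (Literature.MathematicalPhysics.QuantumLattice.FermionTorus 2 L))) ℂ := (fun θ : Fin 2 →
          ℝ => Literature.MathematicalPhysics.QuantumLattice.dGamma (Matrix.of fun o o' :
          Literature.MathematicalPhysics.QuantumLattice.Orb
          (Literature.MathematicalPhysics.QuantumLattice.FermionTorus 2 L) => (if (ofLex o).2 =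
          (ofLex o').2 then ∑ i : Fin 2, ((if ofLex (ofLex o).1 = Function.update (ofLex (ofLex
          o').1) i (ofLex (ofLex o').1 i + 1) then -Complex.exp (Complex.I * ((θ i : ℝ) : ℂ) / (L :
          ℂ)) else 0) + (if ofLex (ofLex o').1 = Function.update (ofLex (ofLex o).1) i (ofLex
          (ofLex o).1 i + 1) then -Complex.exp (-(Complex.I * ((θ i : ℝ) : ℂ) / (L : ℂ))) else 0)) else
          0) - (if o = o' then ((μ : ℝ) : ℂ) else 0)) +
          Literature.MathematicalPhysics.QuantumLattice.hubbardTorus 2 L 0 U);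
        let Z : (Fin 2 → ℝ) → ℝ := fun θ => ((H θ).partitionFn (κ * L)).re;
        (∀ θ : Fin 2 → ℝ, (∀ i, θ i = 0 ∨ θ i = Real.pi) → Real.exp (-C) * Z 0 ≤ Z θ ∧ Z θ ≤
          Real.exp C * Z 0) ∧
        (∀ θ : Fin 2 → ℝ, (∃ i, ∀ m : ℤ, ε ≤ |θ i - m * Real.pi|) → Z θ ≤ Real.exp (-(c * L)) * Z
          0)) →
      ∀ κ : ℝ, κ₀ ≤ κ → ∃ C : ℝ, ∃ L₀ : ℕ, ∀ (L : ℕ) [NeZero L], Even L → L₀ ≤ L →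
        let H : (Fin 2 → ℝ) → Matrix (Finset (Literature.MathematicalPhysics.QuantumLattice.Orb
          (Literature.MathematicalPhysics.QuantumLattice.FermionTorus 2 L))) (Finset
          (Literature.MathematicalPhysics.QuantumLattice.Orb
          (Literature.MathematicalPhysics.QuantumLattice.FermionTorus 2 L))) ℂ := (fun θ : Fin 2 →
          ℝ => Literature.MathematicalPhysics.QuantumLattice.dGamma (Matrix.of fun o o' :
          Literature.MathematicalPhysics.QuantumLattice.Orb
          (Literature.MathematicalPhysics.QuantumLattice.FermionTorus 2 L) => (if (ofLex o).2 =
          (ofLex o').2 then ∑ i : Fin 2, ((if ofLex (ofLex o).1 = Function.update (ofLex (ofLex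
          o').1) i (ofLex (ofLex o').1 i + 1) then -Complex.exp (Complex.I * ((θ i : ℝ) : ℂ) / (L :
          ℂ)) else 0) + (if ofLex (ofLex o').1 = Function.update (ofLex (ofLex o).1) i (ofLex
          (ofLex o).1 i + 1) then -Complex.exp (-(Complex.I * ((θ i : ℝ) : ℂ) / (L : ℂ))) else 0)) else
          0) - (if o = o' then ((μ : ℝ) : ℂ) else 0)) +
          Literature.MathematicalPhysics.QuantumLattice.hubbardTorus 2 L 0 U);
        let Z : (Fin 2 → ℝ) → ℝ := fun θ => ((H θ).partitionFn (κ * L)).re;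
        let ZP : (Fin 2 → ℝ) → ℝ := fun θ =>
          (Literature.MathematicalPhysics.QuantumLattice.parityOp * (H θ).gibbsWeight (κ *
          L)).trace.re;
        Real.exp (-C) * Z 0 ≤ |ZP (fun _ => 0)| + |ZP (fun i => if i = 0 then Real.pi else 0)| +
          |ZP (fun i => if i = 0 then 0 else Real.pi)| + |ZP (fun _ => Real.pi)| := by
  sorry

/-- **STUB 3 `stub_fluxPeriodic` — `2πℤ²`-PERIODICITY OF THE TWISTED PARTITION FUNCTION**
(structural; Byers–Yang / large gauge transformations). For every `L ≥ 1`, twist `θ`, integer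
vector `m`, chemical potential `μ`, coupling `U` and `β`:
`tr e^{-β (dΓ(twistedOneBody L (θ + 2πm) μ) + hubbardTorus 2 L 0 U)} =
 tr e^{-β (dΓ(twistedOneBody L θ μ) + hubbardTorus 2 L 0 U)}`.
Proof route: the site-phase unitary `W = phaseGauge g`, `g x = exp(2πi Σⱼ mⱼ xⱼ/L)` (well defined
on `(ℤ/L)²` because `mⱼ ∈ ℤ`), satisfies `W dΓ(h) Wᴴ = dΓ(g h ḡ)` termwise
(`phaseGauge_mul_creation_mul_conjTranspose`, `phaseGauge_mul_annihilation_mul_conjTranspose`),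
and `g(x) (twistedOneBody L θ μ)_{xσ,x'σ} conj g(x') = (twistedOneBody L (θ + 2πm) μ)_{xσ,x'σ}`
(a bond `x = x' + eᵢ` picks up `e^{2πi mᵢ/L}`, also across the seam since `e^{2πi mᵢ} = 1`); the
interaction `U Σ n↑n↓` commutes with `W`; the trace of `e^{-β Wᴴ H W} = Wᴴ e^{-βH} W` equals that of
`e^{-βH}`. Byers–Yang, PRL 7 (1961) 46; Watanabe, J. Stat. Phys. 177 (2019) 717, §2.2. -/
theorem stub_fluxPeriodic :
    ∀ (L : ℕ) [NeZero L] (θ : Fin 2 → ℝ) (m : Fin 2 → ℤ) (μ U β : ℝ),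
      Matrix.partitionFn β (dGamma (twistedOneBody L (fun i => θ i + 2 * Real.pi * (m i : ℝ)) μ) +
          hubbardTorus 2 L 0 U) =
        Matrix.partitionFn β (dGamma (twistedOneBody L θ μ) + hubbardTorus 2 L 0 U) := by
  sorry

/-- **STUB 4 `stub_untwisted_eq_hubbardTorusWith` — THE UNTWISTED MEMBER IS THE ROUTE'S
GRAND-CANONICAL HAMILTONIAN** (structural). For `L ≥ 3`:
`dΓ(twistedOneBody L 0 μ) + hubbardTorus 2 L 0 U = hubbardTorusWith 2 L 1 U μ`.
Both sides are `-Σ_{x,σ} Σᵢ (c†_{x+eᵢ,σ} c_{x,σ} + c†_{x,σ} c_{x+eᵢ,σ}) + U Σ_x n_{x↑} n_{x↓} - μ N`: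
unfold `dGamma`, `twistedOneBody_apply_orb` at `θ = 0` (entries `-[x = x'+eᵢ] - [x' = x+eᵢ]`,
diagonal `-μ`), `hubbardTorusWith_eq`, `hubbardTorus`, `hamiltonian` (hopping over ORDERED adjacent
pairs of `fermionTorusGraph 2 L`, adjacency `↔ y = x ± eᵢ` for `L ≥ 3`, cf.
`torusGraph_two_adj_iff`, `sum_sum_ite_torusGraph_two_adj`, `magneticHubbardTorus_one_eq_hubbardTorus`),
and `totalNumber = Σ_{x,σ} c†_{xσ} c_{xσ}`. False for `L = 2` (directed bonds double count).
Scalapino–White–Zhang, PRB 47 (1993) 7995 §II (the untwisted Hamiltonian). -/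
theorem stub_untwisted_eq_hubbardTorusWith :
    ∀ (L : ℕ) [NeZero L], 3 ≤ L → ∀ (μ U : ℝ),
      dGamma (twistedOneBody L 0 μ) + hubbardTorus 2 L 0 U = hubbardTorusWith 2 L 1 U μ := by
  sorry

/-! ## The composition: the stubs imply the crux, by name -/

/-- Shifting every coordinate of a twist by an integer multiple of `2π` preserves the property
"some coordinate is `ε`-far from `πℤ`". [folklore] -/
theorem exists_far_of_shift {ε : ℝ} {θ : Fin 2 → ℝ} (m : Fin 2 → ℤ)
    (h : ∃ i, ∀ k : ℤ, ε ≤ |θ i - k * Real.pi|) :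
    ∃ i, ∀ k : ℤ, ε ≤ |(θ i + 2 * Real.pi * (m i : ℝ)) - k * Real.pi| := by
  obtain ⟨i, hi⟩ := h
  refine ⟨i, fun k => ?_⟩
  have h1 := hi (k - 2 * m i)
  have e : θ i + 2 * Real.pi * (m i : ℝ) - (k : ℝ) * Real.pi =
      θ i - ((k - 2 * m i : ℤ) : ℝ) * Real.pi := by
    push_cast
    ring
  rwa [e]

/-- Reducing a twist to the fundamental box `[0,2π)²` by integer shifts: with
`mᵢ = -⌊θᵢ/2π⌋`, `0 ≤ θᵢ + 2π mᵢ < 2π`. [folklore] -/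
theorem shift_mem_box (θ : Fin 2 → ℝ) (i : Fin 2) :
    0 ≤ θ i + 2 * Real.pi * ((-⌊θ i / (2 * Real.pi)⌋ : ℤ) : ℝ) ∧
      θ i + 2 * Real.pi * ((-⌊θ i / (2 * Real.pi)⌋ : ℤ) : ℝ) < 2 * Real.pi := by
  have hπ : 0 < 2 * Real.pi := by positivity
  have h1 := Int.floor_le (θ i / (2 * Real.pi))
  have h2 := Int.lt_floor_add_one (θ i / (2 * Real.pi))
  have e : θ i = 2 * Real.pi * (θ i / (2 * Real.pi)) := by field_simp
  push_cast
  constructor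
  · nlinarith
  · nlinarith

/-- **`SsrRigidity_of`** — the four stubs imply the crux, in the harness skeleton convention
(A12: concludes the crux BY NAME, no hypotheses, cites the declared stubs by name; its only
`sorryAx` dependence is through them). Phase point, (D'), (R1), (R2') from stub 1; (D) from (D')
by stub 4 (`L + 1 ≥ 3` eventually); (R2) from (R2') by stub 3 (reduction of `θ` to `[0,2π)²`);
(T) from stub 2 at the same point; constants merged with `0 ≤ Z(0)` (Hermiticity,
`Matrix.partitionFn_pos`) and monotonicity of `Real.exp`. [folklore] -/
theorem SsrRigidity_of :
    Summit.HubbardSuperconductivity.HubbardSuperconductivity.Theses.SpinStructureRigidity.SsrRigidity := by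
  obtain ⟨U, hU, μ, n, hn, κ₀, hκ₀, hdens', hflux'⟩ := stub_fluxRigidPhase
  -- (D) from (D') and stub 4
  have hdens : ∀ κ : ℝ, κ₀ ≤ κ → Filter.Tendsto (fun L : ℕ =>
      ((hubbardTorusWith 2 (L + 1) 1 U μ).gibbsState (κ * ((L + 1 : ℕ) : ℝ)) totalNumber).re /
        ((L + 1 : ℕ) : ℝ) ^ 2) Filter.atTop (nhds n) := by
    intro κ hκ
    refine (hdens' κ hκ).congr' ?_
    filter_upwards [Filter.eventually_ge_atTop 2] with L hL
    rw [stub_untwisted_eq_hubbardTorusWith (L + 1) (by omega)]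
  -- the full flux half from (R1), (R2') and stub 3
  have hflux : ∀ κ : ℝ, κ₀ ≤ κ → ∀ ε : ℝ, 0 < ε → ∃ C c : ℝ, 0 < c ∧ ∃ L₀ : ℕ, ∀ (L : ℕ) [NeZero L],
      Even L → L₀ ≤ L →
        let H : (Fin 2 → ℝ) → Matrix (Finset (Orb (FermionTorus 2 L))) (Finset (Orb (FermionTorus 2 L))) ℂ :=
          (fun θ : Fin 2 → ℝ => dGamma (Matrix.of fun o o' : Orb (FermionTorus 2 L) =>
            (if (ofLex o).2 = (ofLex o').2 then ∑ i : Fin 2,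
              ((if ofLex (ofLex o).1 = Function.update (ofLex (ofLex o').1) i (ofLex (ofLex o').1 i + 1)
                then -Complex.exp (Complex.I * ((θ i : ℝ) : ℂ) / (L : ℂ)) else 0) +
               (if ofLex (ofLex o').1 = Function.update (ofLex (ofLex o).1) i (ofLex (ofLex o).1 i + 1)
                then -Complex.exp (-(Complex.I * ((θ i : ℝ) : ℂ) / (L : ℂ))) else 0)) else 0) -
            (if o = o' then ((μ : ℝ) : ℂ) else 0)) + hubbardTorus 2 L 0 U);
        let Z : (Fin 2 → ℝ) → ℝ := fun θ => ((H θ).partitionFn (κ * L)).re;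
        (∀ θ : Fin 2 → ℝ, (∀ i, θ i = 0 ∨ θ i = Real.pi) →
            Real.exp (-C) * Z 0 ≤ Z θ ∧ Z θ ≤ Real.exp C * Z 0) ∧
        (∀ θ : Fin 2 → ℝ, (∃ i, ∀ m : ℤ, ε ≤ |θ i - m * Real.pi|) →
            Z θ ≤ Real.exp (-(c * L)) * Z 0) := by
    intro κ hκ ε hε
    obtain ⟨C, c, hc, L₀, h⟩ := hflux' κ hκ ε hε
    refine ⟨C, c, hc, L₀, ?_⟩
    intro L _ hE hL H Z
    have h' := @h L _ hE hL
    refine ⟨h'.1, ?_⟩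
    intro θ hθ
    -- reduce `θ` to the fundamental box by integer shifts
    let m : Fin 2 → ℤ := fun i => -⌊θ i / (2 * Real.pi)⌋
    let θ' : Fin 2 → ℝ := fun i => θ i + 2 * Real.pi * (m i : ℝ)
    have hZ : Z θ' = Z θ := by
      show (Matrix.partitionFn (κ * L) (dGamma (twistedOneBody L θ' μ) + hubbardTorus 2 L 0 U)).re =
        (Matrix.partitionFn (κ * L) (dGamma (twistedOneBody L θ μ) + hubbardTorus 2 L 0 U)).re
      rw [stub_fluxPeriodic L θ m μ U (κ * L)]
    have hbox : ∀ i, 0 ≤ θ' i ∧ θ' i < 2 * Real.pi := fun i => shift_mem_box θ i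
    have hfar : ∃ i, ∀ k : ℤ, ε ≤ |θ' i - k * Real.pi| := exists_far_of_shift m hθ
    rw [← hZ]
    exact h'.2 θ' hbox hfar
  have hpar := stub_parityOrbitOfFluxRigidity U μ κ₀ n hU hκ₀ hn hdens hflux
  refine ⟨U, hU, μ, n, hn, κ₀, hκ₀, hdens, ?_⟩
  intro κ hκ ε hε
  obtain ⟨C₁, c, hc, L₁, h₁⟩ := hflux κ hκ ε hε
  obtain ⟨C₂, L₂, h₂⟩ := hpar κ hκ
  refine ⟨max C₁ C₂, c, hc, max L₁ L₂, ?_⟩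
  intro L _ hE hL H Z ZP
  have hF := @h₁ L _ hE ((le_max_left L₁ L₂).trans hL)
  have hP := @h₂ L _ hE ((le_max_right L₁ L₂).trans hL)
  -- positivity of the untwisted partition function (Hermiticity of the inlined Hamiltonian)
  have hZ0 : 0 ≤ Z 0 := by
    show 0 ≤ (partitionFn (κ * L) (dGamma (twistedOneBody L 0 μ) + hubbardTorus 2 L 0 U)).re
    have hH : (dGamma (twistedOneBody L 0 μ) + hubbardTorus 2 L 0 U).IsHermitian :=
      (isHermitian_dGamma (twistedOneBody_isHermitian 0 μ)).add
        (hamiltonian_isHermitian_and_commute_holds (fermionTorusGraph 2 L) 0 U).1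
    have hpos := partitionFn_pos (κ * L) hH
    rw [Complex.lt_def] at hpos
    exact le_of_lt (by simpa using hpos.1)
  -- monotonicity of the merged constant
  have hlo₁ : Real.exp (-max C₁ C₂) * Z 0 ≤ Real.exp (-C₁) * Z 0 :=
    mul_le_mul_of_nonneg_right (Real.exp_le_exp.mpr (neg_le_neg (le_max_left C₁ C₂))) hZ0
  have hlo₂ : Real.exp (-max C₁ C₂) * Z 0 ≤ Real.exp (-C₂) * Z 0 :=
    mul_le_mul_of_nonneg_right (Real.exp_le_exp.mpr (neg_le_neg (le_max_right C₁ C₂))) hZ0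
  have hhi₁ : Real.exp C₁ * Z 0 ≤ Real.exp (max C₁ C₂) * Z 0 :=
    mul_le_mul_of_nonneg_right (Real.exp_le_exp.mpr (le_max_left C₁ C₂)) hZ0
  refine ⟨fun θ hθ => ⟨hlo₁.trans (hF.1 θ hθ).1, (hF.1 θ hθ).2.trans hhi₁⟩, hF.2, hlo₂.trans hP⟩

end Summit.HubbardSuperconductivity.HubbardSuperconductivity.Cruxes.SsrRigidity.Birth

end
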